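import Summits.HodgeConjecture.HodgeConjecture.Theorems.K2E1bDSClsOfRecord                      -- ★ p856729 (Q9c): `dsCellRep`, `dsClsOfRecord`, `dsClsOfRecord_of_regular`, `dsCarriersOfRecord`
import Literature.RepresentationTheory.BorelWallach2000.UpqHodgeBigrading                        -- ★ `upqZ0` (`z₀ = i(E₁₁+E₂₂) ∈ 𝔨`), `coe_upqZ0`, `upqZ0_mem_kInLie`
import Literature.NumberTheory.Automorphic.GKCohomology                                           -- ★ `RealMatrixGroup.mem_kInLie_iff`
import HarnessLib

/-!
# K2 ∕ E1b unit U8, Deal Q9d `K2E1bDSRecordLawDistinct`: the three classes of record `dsClsOfRecord a b c j` (`j = 0,1,2 ↦ D_φ, D_φ⁺, D_φ⁻`) are DISTINCT —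
# `lawDistinct_dsCarriersOfRecord : dsCarriersOfRecord.LawDistinct` (pays the U8d socket U8-4d BY NAME), via the `z₀`-SPECTRUM class invariant

HCML Track B «K2-LIT», cell `hodgecm-mathlib`, crux H413 = stmt-HodgeConjecture-24833 (supports-only helper; closes nothing by itself).  Deal Q9d of
K2E1b-plan (g3) 2026-09-04T02:39:24Z («GO … the K-spectrum class invariant as you scoped it»); hand K2E4-p10 (g2).  THEOREMS ONLY; no `sorry`, no named
`Prop` fact, no instance (one `attribute [local instance] LieRing.ofAssociativeRing`, the idiom of ★ `K2E1bDSClsOfRecord` ∕ ★ `K2E1bCarriersOfRecord`), no notation.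

THE INVARIANT.  `z₀ := upqZ0 (Fin 2) (Fin 1) = i·(E₁₁ + E₂₂)` is central in `𝔨 = 𝔲(2) ⊕ 𝔲(1)` (★ `UpqHodgeBigrading`).  For a `(𝔤,K)`-equivalence `e` (★ `GKEquiv`,
`e ∘ ρ𝔤(X) = σ𝔤(X) ∘ e`) the EIGENVALUES of `ρ𝔤(X)` and `σ𝔤(X)` coincide for every `X` (§1, `exists_eigenvector_of_gkEquiv`); so «`μ` is an eigenvalue of
`ρ𝔤(z₀)`» is an invariant of the class ★ `GKIrrClass.mk` (★ `GKIrrClass.mk_eq_mk_iff`).  On the STRUCTURE OF RECORD of a Kovačević datum `𝒟` twisted by `e`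
(★ `σOfRecord`, ★ `actsOnKTypesTwist_ofRecord` = the twisted `𝔨`-formulas ★ `ActsOnKTypesTwist`), `z₀` acts on the basis vector `u^k_{n,m}` by the scalar
`i·(m + 2e)∕3` (§2: the off-diagonal entries of `z₀` vanish, the two diagonal weights combine to `(i∕3)·m`, the twist adds `(e∕3)·tr z₀ = (2e∕3)·i`), hence the
eigenvalues of `σOfRecord 𝒟 e z₀` on `𝒟.V = ⊕ ℂu^k_{n,m}` are EXACTLY `{i(m+2e)∕3 : (n,m) ∈ 𝒟.S}` (§3: `⊇` by the basis vectors, `⊆` by reading one non-zero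
coordinate of an eigenvector).  §4: at a regular parameter the `m`-supports of the three cells differ — with `t⁺ − t⁻ = 3(a − c)` and ★ `mem_dsCellDatum_S_iff`:
the `D_φ`-type `(p,q) = (0, a−c)` has `m₀ = 2t⁺ − 3(a−c)`, which is NOT an `m` of `D_φ⁺` (it would need `p = q′ − (a−c) < 0`) nor of `D_φ⁻` (it would need
`p′ − q′ = a − c > b − c − 1 ≥ p′`); the `D_φ⁺`-type `(0,0)` has `m = 2t⁺`, not an `m` of `D_φ⁻` (`p′ − q′ = 2(a−c)`).  Hence the three classes are pairwise
distinct: `lawDistinct_dsCarriersOfRecord`.  (This is the «distinct lowest `K`-types ∕ vertices» argument of the TABLE, run on the `z₀`-weight instead of the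
full `K`-type so that only ONE commuting operator is transported.)

Sources: [BorelWallach2000] 0 §2.5, I §4.3 (equivalences), II §4.1 (`z₀`); [Kovacevic2021] §3 Def. 1, Thm 3, §6; [Rogawski1990] §12.3 p. 178 («ρ, ρ⁺, ρ⁻ are distinct iff
mn ≠ 0»).  HONEST LABEL: HC_CM is proved only modulo the 7 printed citations (2 remaining named inputs: hLiu418 = stmt-HodgeConjecture-24832, h413 = stmt-HodgeConjecture-24833)
until rung 0 closes; a law of the carrier table closes nothing by itself.
-/

set_option autoImplicit false
set_option linter.dupNamespace false

noncomputable section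

open Literature.NumberTheory.Automorphic
open Literature.RepresentationTheory
open Literature.RepresentationTheory.BorelWallach2000
open Literature.RepresentationTheory.KonnoKonno2007 Literature.RepresentationTheory.KonnoKonno2007.RealDualPair
open Literature.RepresentationTheory.Kovacevic2021 Literature.RepresentationTheory.Kovacevic2021.SU21Datum
open Summit.HodgeConjecture.HodgeConjecture.Cruxes.H413.F0P3bLocalAPacketsDefs
open Summit.HodgeConjecture.HodgeConjecture.Cruxes.H413.F0P3bKTypeIntegration (KIdx kvec kvec_of_pos kvec_eq_single single_eq_kvec)
open Summit.HodgeConjecture.HodgeConjecture.Cruxes.H413.K2E1bGKCohomologyU21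
open Summit.HodgeConjecture.HodgeConjecture.Cruxes.H413.K2E1bGKCohomologyU21.U8
open Summit.HodgeConjecture.HodgeConjecture.Cruxes.H413.K2E1bGKCohomologyU21.U8.LevelB
open Summit.HodgeConjecture.HodgeConjecture.Cruxes.H413.K2E1bCarriersOfRecord
open Summit.HodgeConjecture.HodgeConjecture.Cruxes.H413.K2E1bDSCellData
open Summit.HodgeConjecture.HodgeConjecture.Cruxes.H413.K2E1bDSClsOfRecord

namespace Summit.HodgeConjecture.HodgeConjecture.Cruxes.H413.K2E1bDSRecordLawDistinct

-- Mathlib idiom (as in ★ `K2E1bDSClsOfRecord`, ★ `GKModules`): `Module.End ℂ V` ∕ matrices as Lie rings by commutators.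
attribute [local instance 100] LieRing.ofAssociativeRing

/-! ## §1 Eigenvalues of `ρ𝔤(X)` are a `(𝔤,K)`-equivalence invariant -/

/-- **A `(𝔤,K)`-equivalence transports eigenvectors of `ρ𝔤(X)`** (`e (ρ𝔤 X v) = σ𝔤 X (e v)`, `e` a linear isomorphism): if `μ` is an eigenvalue of `ρ𝔤 X` then it
is one of `σ𝔤 X`. [cite: BorelWallach2000, I §4.3] -/
theorem exists_eigenvector_of_gkEquiv {V W : Type*} [AddCommGroup V] [Module ℂ V] [AddCommGroup W] [Module ℂ W]
    {ρK : Representation ℂ G21.maximalCompact V} {ρ𝔤 : G21.lie →ₗ⁅ℝ⁆ Module.End ℂ V}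
    {σK : Representation ℂ G21.maximalCompact W} {σ𝔤 : G21.lie →ₗ⁅ℝ⁆ Module.End ℂ W}
    (e : GKEquiv ρK ρ𝔤 σK σ𝔤) (X : G21.lie) (μ : ℂ) (h : ∃ v : V, v ≠ 0 ∧ ρ𝔤 X v = μ • v) :
    ∃ w : W, w ≠ 0 ∧ σ𝔤 X w = μ • w := by
  obtain ⟨v, hv, hμ⟩ := h
  refine ⟨e.toLinearEquiv v, fun h0 => hv ((LinearEquiv.map_eq_zero_iff _).1 h0), ?_⟩
  rw [← e.map_ρ𝔤, hμ, map_smul]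

/-! ## §2 `z₀ = i(E₁₁+E₂₂)` acts on `u^k_{n,m}` by `i(m + 2e)∕3` in the structure of record -/

/-- `z₀` as an element of the compact Lie algebra `𝔨 = 𝔲(2) ⊕ 𝔲(1)` of `U(2,1)` (★ `upqZ0_mem_kInLie`, ★ `RealMatrixGroup.mem_kInLie_iff`). [cite: BorelWallach2000, II §4.1] -/
theorem upqZ0_coe_mem_compactLie : ((upqZ0 (Fin 2) (Fin 1) : G21.lie) : Matrix (Fin 2 ⊕ Fin 1) (Fin 2 ⊕ Fin 1) ℂ) ∈ G21.compactLie :=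
  (RealMatrixGroup.mem_kInLie_iff G21 _).1 upqZ0_mem_kInLie

/-- **The `z₀`-WEIGHT of `u^k_{n,m}`**: `σOfRecord 𝒟 e z₀ (u^k_{n,m}) = (i(m + 2e)∕3) • u^k_{n,m}` for every `K`-type `(n,m)` of `𝒟` and `1 ≤ k ≤ n`
(★ `actsOnKTypesTwist_ofRecord` at `X = z₀`: `X₁₁ = X₂₂ = i`, `X₃₃ = X₁₂ = X₂₁ = 0`). [cite: Kovacevic2021, §3 Def. 1] [cite: BorelWallach2000, II §4.1; VI §4 4.7–4.8] -/
theorem σOfRecord_upqZ0_kvec (𝒟 : SU21Datum) (e : ℤ) {n m k : ℤ} (hS : (n, m) ∈ 𝒟.S) (hk : 1 ≤ k) (hkn : k ≤ n) :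
    σOfRecord 𝒟 e (upqZ0 (Fin 2) (Fin 1)) (kvec 𝒟.S n m k) = (Complex.I * (((m : ℂ) + 2 * (e : ℂ)) / 3)) • kvec 𝒟.S n m k := by
  have h := actsOnKTypesTwist_ofRecord 𝒟 e ⟨_, upqZ0_coe_mem_compactLie⟩ n m k hS hk hkn
  have hincl : (LieSubalgebra.inclusion G21.compactLie_le_lie ⟨_, upqZ0_coe_mem_compactLie⟩ : G21.lie) = upqZ0 (Fin 2) (Fin 1) :=
    Subtype.ext rfl
  have hX : ((⟨_, upqZ0_coe_mem_compactLie⟩ : G21.compactLie) : Matrix (Fin 2 ⊕ Fin 1) (Fin 2 ⊕ Fin 1) ℂ) =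
      Matrix.fromBlocks (Complex.I • (1 : Matrix (Fin 2) (Fin 2) ℂ)) 0 0 0 := rfl
  rw [hincl, hX] at h
  rw [h]
  simp only [Matrix.fromBlocks_apply₁₁, Matrix.fromBlocks_apply₂₂, Matrix.smul_apply, Matrix.one_apply_eq,
    Matrix.one_apply_ne (show (0 : Fin 2) ≠ 1 by decide), Matrix.one_apply_ne (show (1 : Fin 2) ≠ 0 by decide),
    Matrix.zero_apply, smul_eq_mul, mul_one, mul_zero, neg_zero, zero_mul, zero_smul, add_zero, ← add_smul]
  congr 1
  ring

/-! ## §3 The eigenvalues of `z₀` on the module of record are exactly the `z₀`-weights of the `K`-types -/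

/-- **Every `z₀`-weight is an eigenvalue**: `u^1_{n,m}` is a (non-zero) eigenvector with eigenvalue `i(m+2e)∕3`. [cite: Kovacevic2021, §3 Def. 1] -/
theorem exists_eigenvector_of_mem (𝒟 : SU21Datum) (e : ℤ) {n m : ℤ} (hS : (n, m) ∈ 𝒟.S) :
    ∃ v : 𝒟.V, v ≠ 0 ∧ σOfRecord 𝒟 e (upqZ0 (Fin 2) (Fin 1)) v = (Complex.I * (((m : ℂ) + 2 * (e : ℂ)) / 3)) • v := by
  have h1 : (1 : ℤ) ≤ n := 𝒟.one_le_of_mem hS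
  refine ⟨kvec 𝒟.S n m 1, ?_, σOfRecord_upqZ0_kvec 𝒟 e hS le_rfl h1⟩
  rw [kvec_of_pos ⟨hS, le_rfl, h1⟩]
  exact Finsupp.single_ne_zero.2 one_ne_zero

/-- **Every eigenvalue is a `z₀`-weight**: if `σOfRecord 𝒟 e z₀ v = μ • v` with `v ≠ 0` then `μ = i(m+2e)∕3` for some `K`-type `(n,m)` of `𝒟` (read the eigen-equation
at one label in the support of `v`: `z₀` is DIAGONAL in the basis `u^k_{n,m}`). [cite: Kovacevic2021, §3 Def. 1] [cite: BorelWallach2000, 0 §2.5] -/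
theorem exists_mem_of_eigenvector (𝒟 : SU21Datum) (e : ℤ) {μ : ℂ} {v : 𝒟.V} (hv : v ≠ 0)
    (h : σOfRecord 𝒟 e (upqZ0 (Fin 2) (Fin 1)) v = μ • v) :
    ∃ n m : ℤ, (n, m) ∈ 𝒟.S ∧ μ = Complex.I * (((m : ℂ) + 2 * (e : ℂ)) / 3) := by
  classical
  obtain ⟨t₀, ht₀⟩ := Finset.nonempty_iff_ne_empty.2 (fun h0 => hv (Finsupp.support_eq_empty.1 h0))
  refine ⟨t₀.1.1, t₀.1.2.1, t₀.2.1, ?_⟩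
  set T := σOfRecord 𝒟 e (upqZ0 (Fin 2) (Fin 1)) with hT
  -- `z₀` is diagonal in the basis `u^k_{n,m} = single ⟨(n,m,k)⟩ 1`
  have hdiag : ∀ t : KIdx 𝒟.S, T (Finsupp.single t 1) =
      (Complex.I * ((((t.1.2.1 : ℤ) : ℂ) + 2 * (e : ℂ)) / 3)) • Finsupp.single t 1 := by
    rintro ⟨⟨n, m, k⟩, hS, hk, hkn⟩
    have := σOfRecord_upqZ0_kvec 𝒟 e hS hk hkn
    rw [kvec_of_pos ⟨hS, hk, hkn⟩] at this
    exact this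
  -- hence the `t₀`-coordinate of `T w` is the `t₀`-weight times the `t₀`-coordinate of `w`
  have hcoord : ∀ w : 𝒟.V, (T w) t₀ = (Complex.I * ((((t₀.1.2.1 : ℤ) : ℂ) + 2 * (e : ℂ)) / 3)) * w t₀ := by
    intro w
    refine Finsupp.induction_linear w ?_ ?_ ?_
    · rw [map_zero, Finsupp.zero_apply, mul_zero]
    · intro f g hf hg
      rw [map_add, Finsupp.add_apply, hf, hg, Finsupp.add_apply, mul_add]
    · intro t a
      rw [← Finsupp.smul_single_one, map_smul, hdiag, smul_smul, Finsupp.smul_apply, Finsupp.smul_apply, smul_eq_mul, smul_eq_mul,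
        Finsupp.single_apply]
      by_cases ht : t = t₀
      · subst ht
        simp only [if_true]
        ring
      · rw [if_neg ht, mul_zero, mul_zero, mul_zero]
  have hμv : (T v) t₀ = μ * v t₀ := by rw [h, Finsupp.smul_apply, smul_eq_mul]
  have hne : v t₀ ≠ 0 := Finsupp.mem_support_iff.1 ht₀
  exact mul_right_cancel₀ hne (hμv.symm.trans (hcoord v))

/-! ## §4 The three cells have different `z₀`-spectra at a regular parameter -/

section Regular

variable {a b c : ℤ}

/-- Two classes of record with a common `z₀`-eigenvalue-transport: if `dsClsOfRecord a b c j = dsClsOfRecord a b c j′` then every `z₀`-weight `m` of the cell `j`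
is a `z₀`-weight of the cell `j′` (same twist `e = centralOf a b c` on both sides). [cite: BorelWallach2000, I §4.3] [cite: Rogawski1990, §12.3 p. 178] -/
theorem exists_weight_of_cls_eq (h : IsRegularParam a b c) {j j' : Fin 3} (hcls : dsClsOfRecord a b c j = dsClsOfRecord a b c j')
    {n m : ℤ} (hS : (n, m) ∈ (dsCellDatum j a b c).S) :
    ∃ n' m' : ℤ, (n', m') ∈ (dsCellDatum j' a b c).S ∧ m' = m := by
  rw [dsClsOfRecord_of_regular h j, dsClsOfRecord_of_regular h j', GKIrrClass.mk_eq_mk_iff] at hcls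
  obtain ⟨eqv⟩ := hcls
  obtain ⟨w, hw, hTw⟩ := exists_eigenvector_of_gkEquiv eqv (upqZ0 (Fin 2) (Fin 1)) _
    (exists_eigenvector_of_mem (dsCellDatum j a b c) (centralOf a b c) hS)
  obtain ⟨n', m', hS', hμ⟩ := exists_mem_of_eigenvector (dsCellDatum j' a b c) (centralOf a b c) hw hTw
  refine ⟨n', m', hS', ?_⟩
  have h3 : ((m' : ℂ) + 2 * ((centralOf a b c : ℤ) : ℂ)) = ((m : ℂ) + 2 * ((centralOf a b c : ℤ) : ℂ)) := by
    have := mul_left_cancel₀ Complex.I_ne_zero hμ.symm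
    field_simp at this
    linear_combination this
  exact_mod_cast (add_right_cancel h3 : (m' : ℂ) = (m : ℂ))

/-- `D_φ ≠ D_φ⁺`: the `D_φ`-type `(p,q) = (0, a−c)` has `m₀ = 2t⁺ − 3(a−c)`, which no `D_φ⁺`-type has (`p = q′ − (a−c) ≤ (a−b−1) − (a−c) < 0`).
[cite: Rogawski1990, §12.3 p. 178] -/
theorem dsClsOfRecord_zero_ne_one (h : IsRegularParam a b c) : dsClsOfRecord a b c 0 ≠ dsClsOfRecord a b c 1 := by
  intro hcls
  obtain ⟨h1, h2⟩ := id h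
  have hS : ((1 + 0 + (a - c), 2 * tPlus a b c + 3 * 0 - 3 * (a - c)) : ℤ × ℤ) ∈ (dsCellDatum 0 a b c).S :=
    ((mem_dsCellDatum_S_iff h _ _).1).2 ⟨0, a - c, le_rfl, by omega, rfl, rfl, le_rfl⟩
  obtain ⟨n', m', hS', hm⟩ := exists_weight_of_cls_eq h hcls hS
  obtain ⟨p, q, hp, hq, -, hm', hq'⟩ := ((mem_dsCellDatum_S_iff h n' m').2.1).1 hS'
  omega

/-- `D_φ ≠ D_φ⁻`: the same `D_φ`-type has `m₀ = 2t⁻ + 3(a−c)` on the `(−)`-series (`t⁺ − t⁻ = 3(a−c)`), which would need `p′ − q′ = a − c > b − c − 1 ≥ p′`.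
[cite: Rogawski1990, §12.3 p. 178] -/
theorem dsClsOfRecord_zero_ne_two (h : IsRegularParam a b c) : dsClsOfRecord a b c 0 ≠ dsClsOfRecord a b c 2 := by
  intro hcls
  obtain ⟨h1, h2⟩ := id h
  have hS : ((1 + 0 + (a - c), 2 * tPlus a b c + 3 * 0 - 3 * (a - c)) : ℤ × ℤ) ∈ (dsCellDatum 0 a b c).S :=
    ((mem_dsCellDatum_S_iff h _ _).1).2 ⟨0, a - c, le_rfl, by omega, rfl, rfl, le_rfl⟩
  obtain ⟨n', m', hS', hm⟩ := exists_weight_of_cls_eq h hcls hS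
  obtain ⟨p, q, hp, hq, -, hm', hp'⟩ := ((mem_dsCellDatum_S_iff h n' m').2.2).1 hS'
  simp only [tPlus, tMinus] at hm hm'
  omega

/-- `D_φ⁺ ≠ D_φ⁻`: the `D_φ⁺`-type `(0,0)` has `m = 2t⁺ = 2t⁻ + 6(a−c)`, which would need `p′ − q′ = 2(a−c) > b − c − 1 ≥ p′` on the `(−)`-series.
[cite: Rogawski1990, §12.3 p. 178] -/
theorem dsClsOfRecord_one_ne_two (h : IsRegularParam a b c) : dsClsOfRecord a b c 1 ≠ dsClsOfRecord a b c 2 := by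
  intro hcls
  obtain ⟨h1, h2⟩ := id h
  have hS : ((1 + 0 + 0, 2 * tPlus a b c + 3 * 0 - 3 * 0) : ℤ × ℤ) ∈ (dsCellDatum 1 a b c).S :=
    ((mem_dsCellDatum_S_iff h _ _).2.1).2 ⟨0, 0, le_rfl, le_rfl, rfl, rfl, by omega⟩
  obtain ⟨n', m', hS', hm⟩ := exists_weight_of_cls_eq h hcls hS
  obtain ⟨p, q, hp, hq, -, hm', hp'⟩ := ((mem_dsCellDatum_S_iff h n' m').2.2).1 hS'
  simp only [tPlus, tMinus] at hm hm'
  omega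

/-- **LAW «three distinct members» for the table of record**: `dsCarriersOfRecord.LawDistinct` — at a regular parameter `j ↦ dsClsOfRecord a b c j` is injective
(«ρ, ρ⁺, ρ⁻ are distinct», here by their `z₀`-spectra). [cite: Rogawski1990, §12.3 p. 178] [cite: BorelWallach2000, I §4.3] -/
theorem lawDistinct_dsCarriersOfRecord : dsCarriersOfRecord.LawDistinct := by
  intro a b c h j j' hjj'
  change dsClsOfRecord a b c j = dsClsOfRecord a b c j' at hjj'
  fin_cases j <;> fin_cases j'
  · rfl
  · exact absurd hjj' (dsClsOfRecord_zero_ne_one h)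
  · exact absurd hjj' (dsClsOfRecord_zero_ne_two h)
  · exact absurd hjj'.symm (dsClsOfRecord_zero_ne_one h)
  · rfl
  · exact absurd hjj' (dsClsOfRecord_one_ne_two h)
  · exact absurd hjj'.symm (dsClsOfRecord_zero_ne_two h)
  · exact absurd hjj'.symm (dsClsOfRecord_one_ne_two h)
  · rfl

end Regular

end Summit.HodgeConjecture.HodgeConjecture.Cruxes.H413.K2E1bDSRecordLawDistinct

end
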